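import Summits.CriticalPhenomena.Ising3DConformalLimit.Theorems.SynchronousCouplingRotationJoiningIsotropyDefs
import HarnessLib

/-!
# Method of moments, difference form — tools: Taylor control of characteristic functions
(route `SynchronousCoupling`, crux `RotationJoining`, stmt-CriticalPhenomena-18763, line `SketchIdeator2`,
reshape 2; registered tool sub-goal `stub_momentsToCharDiff` of the stub `stub_momentsToTests` = `MomentsToTests`)

Pure probability / calculus, nothing lattice-specific.

* `norm_cexp_mul_I_sub_sum_le`: `‖exp(ix) - Σ_{m<N} (ix)^m/m!‖ ≤ |x|^N/N!` for real `x` (induction on `N` by the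
  fundamental theorem of calculus: the order-`N+1` remainder vanishes at `0` and has derivative `i`·(order-`N`
  remainder)).
* `norm_integral_cexp_sub_sum_le`: integrated form `‖E e^{iW} - Σ_{m<N} E[W^m] i^m/m!‖ ≤ E|W|^N/N!` for a bounded
  real random variable `W`.
* `tendsto_integral_cexp_sub_of_moments`: two sequences of bounded real random variables with even moments
  `E[W^{2k}] ≤ (Ck)^k` (uniformly in `n`) and asymptotically equal moments have asymptotically equal `E e^{iW}`:
  the even-order remainders are `≤ (Ck)^k/(2k)! ≤ |C|^k/k! → 0` uniformly (`k^k k! ≤ (2k)!`), and the Taylor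
  polynomials are finite combinations of moments.
* `stub_momentsToCharDiff` (registered): the vector version — for `X n, Y n : Ω → (Fin j → ℝ)` as in
  `MomentsToTests` and every `t`, `E exp(i Σᵢ (X n)ᵢ tᵢ) - E exp(i Σᵢ (Y n)ᵢ tᵢ) → 0`; the moments of the linear
  form expand into mixed moments (`linForm_pow_eq_sum`, multinomial expansion over maps `Fin m → Fin j`) and are
  sub-Gaussian by Jensen (`linForm_pow_le`: `(Σᵢ xᵢtᵢ)^{2k} ≤ j^{2k-1}‖t‖^{2k} Σᵢ xᵢ^{2k}`).

References: P. Billingsley, *Probability and Measure* (3rd ed. 1995), §26 (Taylor bound (26.4) for `e^{ix}`)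
and Thm 30.1–30.2 (method of moments); all ingredients are Mathlib (`intervalIntegral`, `integral_pow_abs_sub_uIoc`,
`Nat.factorial_mul_pow_le_factorial`, `FloorSemiring.tendsto_pow_div_factorial_atTop`, `pow_sum_le_card_mul_sum_pow`,
`Fintype.sum_pow`, `Finset.prod_fiberwise'`). No definitions, no named facts, no sorry.
-/

noncomputable section

namespace Summit.CriticalPhenomena.Ising3DConformalLimit.Cruxes.RotationJoining.RateSplitting

open MeasureTheory Filter Complex Finset
open scoped Topology BigOperators Real Nat

/-! ### Taylor control of `E exp(iW)` for bounded real random variables -/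

/-- A continuous function of a bounded real random variable is integrable (finite measure). -/
theorem integrable_comp_of_abs_le {Ω : Type*} [MeasurableSpace Ω] (P : Measure Ω) [IsFiniteMeasure P]
    {W : Ω → ℝ} (hW : Measurable W) {B : ℝ} (hB : ∀ ω, |W ω| ≤ B)
    {F : Type*} [NormedAddCommGroup F] {g : ℝ → F} (hg : Continuous g) :
    Integrable (fun ω => g (W ω)) P := by
  obtain ⟨C, hC⟩ := (isCompact_Icc : IsCompact (Set.Icc (-B) B)).exists_bound_of_continuousOn
    hg.continuousOn
  exact Integrable.of_bound (hg.comp_aestronglyMeasurable hW.aestronglyMeasurable) C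
    (Eventually.of_forall fun ω => hC _ (abs_le.1 (hB ω)))

/-- The order-`N` Taylor remainder of `x ↦ exp (i x)` at `0` is bounded by `|x| ^ N / N!`
(induction on `N`: the remainder of order `N + 1` vanishes at `0` and its derivative is `i` times
the remainder of order `N`). -/
theorem norm_cexp_mul_I_sub_sum_le (N : ℕ) (x : ℝ) :
    ‖cexp (x * I) - ∑ m ∈ range N, (x * I) ^ m / (m ! : ℂ)‖ ≤ |x| ^ N / (N ! : ℝ) := by
  induction N generalizing x with
  | zero => simp [Complex.norm_exp_ofReal_mul_I]
  | succ N ih =>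
    have hy : ∀ y : ℝ, HasDerivAt (fun y : ℝ => (y : ℂ) * I) I y := fun y => by
      simpa using (hasDerivAt_id y).ofReal_comp.mul_const I
    have hP : ∀ z : ℝ, ∑ m ∈ range (N + 1), ((z : ℂ) * I) ^ m / (m ! : ℂ)
        = ∑ m ∈ range N, ((z : ℂ) * I) ^ (m + 1) / ((m + 1)! : ℂ) + 1 := by
      intro z
      rw [Finset.sum_range_succ']
      simp
    have hderiv : ∀ y : ℝ,
        HasDerivAt (fun z : ℝ => cexp (z * I) - ∑ m ∈ range (N + 1), ((z : ℂ) * I) ^ m / (m ! : ℂ))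
          (I * (cexp (y * I) - ∑ m ∈ range N, ((y : ℂ) * I) ^ m / (m ! : ℂ))) y := by
      intro y
      have h2 : HasDerivAt (fun z : ℝ => ∑ m ∈ range N, ((z : ℂ) * I) ^ (m + 1) / ((m + 1)! : ℂ))
          (∑ m ∈ range N, ((m + 1 : ℕ) * ((y : ℂ) * I) ^ (m + 1 - 1) * I) / ((m + 1)! : ℂ)) y :=
        HasDerivAt.fun_sum fun m _ => ((hy y).fun_pow (m + 1)).div_const _
      have h3 := (hy y).cexp.fun_sub (h2.add_const 1)
      simp_rw [hP]
      refine h3.congr_deriv ?_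
      rw [mul_sub, Finset.mul_sum]
      congr 1
      · ring
      · refine Finset.sum_congr rfl fun m _ => ?_
        rw [Nat.factorial_succ, Nat.add_sub_cancel]
        push_cast
        field_simp
    have hRc : Continuous fun y : ℝ =>
        I * (cexp (y * I) - ∑ m ∈ range N, ((y : ℂ) * I) ^ m / (m ! : ℂ)) := by
      fun_prop
    have hint : cexp (x * I) - ∑ m ∈ range (N + 1), ((x : ℂ) * I) ^ m / (m ! : ℂ)
        = ∫ y in (0 : ℝ)..x, I * (cexp (y * I) - ∑ m ∈ range N, ((y : ℂ) * I) ^ m / (m ! : ℂ)) := by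
      rw [intervalIntegral.integral_eq_sub_of_hasDerivAt (fun y _ => hderiv y)
        (hRc.intervalIntegrable _ _)]
      simp [Finset.sum_range_succ']
    rw [hint, intervalIntegral.norm_intervalIntegral_eq]
    calc ‖∫ y in Set.uIoc 0 x, I * (cexp (y * I) - ∑ m ∈ range N, ((y : ℂ) * I) ^ m / (m ! : ℂ))‖
        ≤ ∫ y in Set.uIoc 0 x, |y - 0| ^ N / (N ! : ℝ) := by
          refine norm_integral_le_of_norm_le (Continuous.integrableOn_uIoc (by fun_prop))
            (Eventually.of_forall fun y => ?_)
          rw [norm_mul, Complex.norm_I, one_mul, sub_zero]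
          exact ih y
      _ = |x| ^ (N + 1) / ((N + 1)! : ℝ) := by
          rw [integral_div, integral_pow_abs_sub_uIoc, sub_zero, Nat.factorial_succ]
          push_cast
          rw [div_div, mul_comm]

/-- Integrated Taylor bound: for a bounded real random variable `W` and every `N`,
`‖E exp(iW) - Σ_{m<N} E[W^m] i^m / m!‖ ≤ E|W|^N / N!`. -/
theorem norm_integral_cexp_sub_sum_le {Ω : Type*} [MeasurableSpace Ω] (P : Measure Ω)
    [IsFiniteMeasure P] {W : Ω → ℝ} (hW : Measurable W) {B : ℝ} (hB : ∀ ω, |W ω| ≤ B) (N : ℕ) :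
    ‖(∫ ω, cexp (W ω * I) ∂P) - ∑ m ∈ range N, (∫ ω, (W ω) ^ m ∂P : ℝ) * I ^ m / (m ! : ℂ)‖
      ≤ (∫ ω, |W ω| ^ N ∂P) / (N ! : ℝ) := by
  have hterm : ∀ m : ℕ, (∫ ω, (W ω) ^ m ∂P : ℝ) * I ^ m / (m ! : ℂ)
      = ∫ ω, ((W ω : ℂ) * I) ^ m / (m ! : ℂ) ∂P := by
    intro m
    rw [integral_div, ← integral_complex_ofReal, ← integral_mul_const]
    refine congrArg (fun z => z / (m ! : ℂ)) (integral_congr_ae (Eventually.of_forall fun ω => ?_))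
    simp only [ofReal_pow, mul_pow]
  have hint : ∀ m : ℕ, Integrable (fun ω => ((W ω : ℂ) * I) ^ m / (m ! : ℂ)) P := fun m =>
    integrable_comp_of_abs_le P hW hB (g := fun x : ℝ => ((x : ℂ) * I) ^ m / (m ! : ℂ)) (by fun_prop)
  have hexp : Integrable (fun ω => cexp (W ω * I)) P :=
    integrable_comp_of_abs_le P hW hB (g := fun x : ℝ => cexp (x * I)) (by fun_prop)
  have habs : Integrable (fun ω => |W ω| ^ N / (N ! : ℝ)) P :=
    integrable_comp_of_abs_le P hW hB (g := fun x : ℝ => |x| ^ N / (N ! : ℝ)) (by fun_prop)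
  simp_rw [hterm]
  rw [← integral_finsetSum _ (fun m _ => hint m), ← integral_sub hexp (integrable_finsetSum _
    fun m _ => hint m), ← integral_div]
  refine norm_integral_le_of_norm_le habs (Eventually.of_forall fun ω => ?_)
  exact norm_cexp_mul_I_sub_sum_le N (W ω)

/-- `k ^ k * k! ≤ (2k)!`, in the form `(C k)^k / (2k)! ≤ |C| ^ k / k!`. -/
theorem mul_pow_div_factorial_two_mul_le (C : ℝ) (k : ℕ) :
    (C * k) ^ k / ((2 * k) ! : ℝ) ≤ |C| ^ k / (k ! : ℝ) := by
  have hfac : (k ! : ℝ) * (k : ℝ) ^ k ≤ ((2 * k) ! : ℝ) := by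
    have h1 : k ! * (k + 1) ^ k ≤ (k + k) ! := Nat.factorial_mul_pow_le_factorial
    have h2 : k ! * k ^ k ≤ k ! * (k + 1) ^ k :=
      Nat.mul_le_mul_left _ (Nat.pow_le_pow_left (Nat.le_succ k) k)
    rw [two_mul]
    exact_mod_cast h2.trans h1
  have hkpos : (0 : ℝ) < k ! := by positivity
  rw [div_le_div_iff₀ (by positivity) hkpos, mul_pow]
  have hCk : C ^ k ≤ |C| ^ k := (le_abs_self _).trans (abs_pow C k).le
  calc C ^ k * (k : ℝ) ^ k * (k ! : ℝ) = C ^ k * ((k ! : ℝ) * (k : ℝ) ^ k) := by ring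
    _ ≤ |C| ^ k * ((k ! : ℝ) * (k : ℝ) ^ k) := mul_le_mul_of_nonneg_right hCk (by positivity)
    _ ≤ |C| ^ k * ((2 * k) ! : ℝ) := by gcongr

/-- **Method of moments for characteristic functions, difference form (one-dimensional).**
Two sequences of bounded real random variables with uniformly sub-Gaussian even moments
`E[W^{2k}] ≤ (C k)^k` and asymptotically equal moments have asymptotically equal characteristic
functions at `1`: Taylor-expand `E exp(iW)` to the even order `2k` (remainder `≤ E[W^{2k}]/(2k)! ≤ |C|^k/k!`
uniformly in `n`), and let `n → ∞` in the Taylor polynomials. -/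
theorem tendsto_integral_cexp_sub_of_moments {Ω : Type*} [MeasurableSpace Ω] (P : Measure Ω)
    [IsProbabilityMeasure P] (W W' : ℕ → Ω → ℝ) (hW : ∀ n, Measurable (W n))
    (hW' : ∀ n, Measurable (W' n)) (hbdd : ∀ n, ∃ B : ℝ, ∀ ω, |W n ω| ≤ B ∧ |W' n ω| ≤ B) {C : ℝ}
    (hC : ∀ n k : ℕ, ∫ ω, (W n ω) ^ (2 * k) ∂P ≤ (C * k) ^ k ∧ ∫ ω, (W' n ω) ^ (2 * k) ∂P ≤ (C * k) ^ k)
    (hmom : ∀ m : ℕ, Tendsto (fun n => (∫ ω, (W n ω) ^ m ∂P) - ∫ ω, (W' n ω) ^ m ∂P) atTop (𝓝 0)) :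
    Tendsto (fun n => (∫ ω, cexp (W n ω * I) ∂P) - ∫ ω, cexp (W' n ω * I) ∂P) atTop (𝓝 0) := by
  -- Taylor polynomials of the two characteristic functions at `1`
  set T : ℕ → (Ω → ℝ) → ℂ := fun N V => ∑ m ∈ range N, (∫ ω, (V ω) ^ m ∂P : ℝ) * I ^ m / (m ! : ℂ)
    with hT
  -- uniform remainder bound
  have hrem : ∀ (V : Ω → ℝ), Measurable V → (∃ B : ℝ, ∀ ω, |V ω| ≤ B) →
      ∀ k : ℕ, ∫ ω, (V ω) ^ (2 * k) ∂P ≤ (C * k) ^ k →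
        ‖(∫ ω, cexp (V ω * I) ∂P) - T (2 * k) V‖ ≤ |C| ^ k / (k ! : ℝ) := by
    intro V hV hB k hk
    obtain ⟨B, hB⟩ := hB
    refine (norm_integral_cexp_sub_sum_le P hV hB (2 * k)).trans ?_
    refine le_trans ?_ (mul_pow_div_factorial_two_mul_le C k)
    gcongr
    refine le_of_eq_of_le (integral_congr_ae (Eventually.of_forall fun ω => ?_)) hk
    exact Even.pow_abs ⟨k, two_mul k⟩ (V ω)
  rw [Metric.tendsto_atTop]
  intro ε hε
  obtain ⟨k, hk⟩ : ∃ k : ℕ, |C| ^ k / (k ! : ℝ) < ε / 3 :=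
    ((FloorSemiring.tendsto_pow_div_factorial_atTop |C|).eventually
      (gt_mem_nhds (by positivity))).exists
  -- the Taylor polynomials are asymptotically equal
  have hfin : Tendsto (fun n => T (2 * k) (W n) - T (2 * k) (W' n)) atTop (𝓝 0) := by
    have hrw : ∀ n, T (2 * k) (W n) - T (2 * k) (W' n) = ∑ m ∈ range (2 * k),
        (((∫ ω, (W n ω) ^ m ∂P) - ∫ ω, (W' n ω) ^ m ∂P : ℝ) : ℂ) * I ^ m / (m ! : ℂ) := by
      intro n
      simp only [hT, ← Finset.sum_sub_distrib, ofReal_sub, sub_mul, sub_div]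
    simp_rw [hrw]
    rw [show (0 : ℂ) = ∑ m ∈ range (2 * k), ((0 : ℝ) : ℂ) * I ^ m / (m ! : ℂ) by simp]
    exact tendsto_finsetSum _ fun m _ => ((hmom m).ofReal.mul_const _).div_const _
  obtain ⟨N₀, hN₀⟩ := Metric.tendsto_atTop.1 hfin (ε / 3) (by positivity)
  refine ⟨N₀, fun n hn => ?_⟩
  obtain ⟨B, hB⟩ := hbdd n
  have h1 := hrem (W n) (hW n) ⟨B, fun ω => (hB ω).1⟩ k (hC n k).1
  have h2 := hrem (W' n) (hW' n) ⟨B, fun ω => (hB ω).2⟩ k (hC n k).2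
  have h3 := hN₀ n hn
  rw [dist_zero_right] at h3 ⊢
  calc ‖(∫ ω, cexp (W n ω * I) ∂P) - ∫ ω, cexp (W' n ω * I) ∂P‖
      = ‖((∫ ω, cexp (W n ω * I) ∂P) - T (2 * k) (W n)) + (T (2 * k) (W n) - T (2 * k) (W' n))
          - ((∫ ω, cexp (W' n ω * I) ∂P) - T (2 * k) (W' n))‖ := by congr 1; ring
    _ ≤ ‖(∫ ω, cexp (W n ω * I) ∂P) - T (2 * k) (W n)‖ + ‖T (2 * k) (W n) - T (2 * k) (W' n)‖
          + ‖(∫ ω, cexp (W' n ω * I) ∂P) - T (2 * k) (W' n)‖ := norm_sub_le_of_le (norm_add_le _ _) le_rfl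
    _ < ε / 3 + ε / 3 + ε / 3 := by
        refine add_lt_add_of_lt_of_le (add_lt_add_of_le_of_lt (h1.trans hk.le) h3) (h2.trans hk.le)
    _ = ε := by ring


/-! ### Linear functionals of bounded random vectors -/

/-- A continuous function of a coordinatewise bounded random vector is integrable (finite measure). -/
theorem integrable_comp_of_coord_abs_le {Ω : Type*} [MeasurableSpace Ω] (P : Measure Ω)
    [IsFiniteMeasure P] {j : ℕ} {X : Ω → (Fin j → ℝ)} (hX : Measurable X) {B : ℝ}
    (hB : ∀ ω i, |X ω i| ≤ B) {F : Type*} [NormedAddCommGroup F] {g : (Fin j → ℝ) → F}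
    (hg : Continuous g) : Integrable (fun ω => g (X ω)) P := by
  obtain ⟨C, hC⟩ := (isCompact_univ_pi fun _ : Fin j => (isCompact_Icc : IsCompact (Set.Icc (-B) B)))
    |>.exists_bound_of_continuousOn hg.continuousOn
  exact Integrable.of_bound (hg.comp_aestronglyMeasurable hX.aestronglyMeasurable) C
    (Eventually.of_forall fun ω => hC _ fun i _ => abs_le.1 (hB ω i))

/-- Multinomial expansion of a power of a linear form in terms of monomials:
`(Σᵢ xᵢ tᵢ)^m = Σ_{g : Fin m → Fin j} (∏ₗ t_{g l}) · ∏ᵢ xᵢ ^ #{l | g l = i}`. -/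
theorem linForm_pow_eq_sum {j : ℕ} (t x : Fin j → ℝ) (m : ℕ) :
    (∑ i, x i * t i) ^ m
      = ∑ g : Fin m → Fin j, (∏ l, t (g l)) * ∏ i, x i ^ (univ.filter (fun l => g l = i)).card := by
  rw [Fintype.sum_pow]
  refine Finset.sum_congr rfl fun g _ => ?_
  rw [Finset.prod_mul_distrib, mul_comm, ← Finset.prod_fiberwise' univ g x]
  congr 1
  exact Finset.prod_congr rfl fun i _ => Finset.prod_const _

/-- Jensen-type bound for even powers of a linear form:
`(Σᵢ xᵢ tᵢ)^{2(k+1)} ≤ j^{2k+1} ‖t‖^{2(k+1)} Σᵢ xᵢ^{2(k+1)}` (sup norm on `Fin j → ℝ`). -/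
theorem linForm_pow_le {j : ℕ} (t x : Fin j → ℝ) (k : ℕ) :
    (∑ i, x i * t i) ^ (2 * (k + 1))
      ≤ (j : ℝ) ^ (2 * k + 1) * ‖t‖ ^ (2 * (k + 1)) * ∑ i, x i ^ (2 * (k + 1)) := by
  have h2 : 2 * (k + 1) = (2 * k + 1) + 1 := by ring
  have hev : Even (2 * (k + 1)) := ⟨k + 1, two_mul _⟩
  calc (∑ i, x i * t i) ^ (2 * (k + 1))
      = |∑ i, x i * t i| ^ (2 * (k + 1)) := (hev.pow_abs _).symm
    _ ≤ (∑ i, |x i * t i|) ^ (2 * (k + 1)) :=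
        pow_le_pow_left₀ (abs_nonneg _) (Finset.abs_sum_le_sum_abs _ _) _
    _ ≤ ((#(univ : Finset (Fin j)) : ℝ)) ^ (2 * k + 1) * ∑ i, |x i * t i| ^ (2 * (k + 1)) := by
        rw [h2]
        exact pow_sum_le_card_mul_sum_pow (fun i _ => abs_nonneg _) _
    _ = (j : ℝ) ^ (2 * k + 1) * ∑ i, |t i| ^ (2 * (k + 1)) * x i ^ (2 * (k + 1)) := by
        rw [Finset.card_univ, Fintype.card_fin]
        congr 1
        refine Finset.sum_congr rfl fun i _ => ?_
        rw [abs_mul, mul_pow, hev.pow_abs (x i), mul_comm]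
    _ ≤ (j : ℝ) ^ (2 * k + 1) * ∑ i, ‖t‖ ^ (2 * (k + 1)) * x i ^ (2 * (k + 1)) := by
        gcongr with i _
        · exact hev.pow_nonneg _
        · simpa using norm_le_pi_norm t i
    _ = (j : ℝ) ^ (2 * k + 1) * ‖t‖ ^ (2 * (k + 1)) * ∑ i, x i ^ (2 * (k + 1)) := by
        rw [← Finset.mul_sum]; ring

/-- Sub-Gaussian even moments of the coordinates give sub-Gaussian even moments of every linear form:
`E[(Σᵢ Xᵢ tᵢ)^{2k}] ≤ ((j² ‖t‖² K) k)^k`. -/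
theorem integral_linForm_pow_le {Ω : Type*} [MeasurableSpace Ω] (P : Measure Ω)
    [IsProbabilityMeasure P] {j : ℕ} {X : Ω → (Fin j → ℝ)} (hX : Measurable X) {B : ℝ}
    (hB : ∀ ω i, |X ω i| ≤ B) (t : Fin j → ℝ) {K : ℝ} (k : ℕ)
    (hK : ∀ i, ∫ ω, (X ω i) ^ (2 * k) ∂P ≤ (K * k) ^ k) :
    ∫ ω, (∑ i, X ω i * t i) ^ (2 * k) ∂P ≤ ((j : ℝ) ^ 2 * ‖t‖ ^ 2 * K * k) ^ k := by
  rcases k with _ | k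
  · simp
  calc ∫ ω, (∑ i, X ω i * t i) ^ (2 * (k + 1)) ∂P
      ≤ ∫ ω, (j : ℝ) ^ (2 * k + 1) * ‖t‖ ^ (2 * (k + 1)) * ∑ i, X ω i ^ (2 * (k + 1)) ∂P := by
        refine integral_mono ?_ ?_ fun ω => linForm_pow_le t (X ω) k
        · exact integrable_comp_of_coord_abs_le P hX hB
            (g := fun v => (∑ i, v i * t i) ^ (2 * (k + 1))) (by fun_prop)
        · exact integrable_comp_of_coord_abs_le P hX hB
            (g := fun v => (j : ℝ) ^ (2 * k + 1) * ‖t‖ ^ (2 * (k + 1)) * ∑ i, v i ^ (2 * (k + 1)))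
            (by fun_prop)
    _ = (j : ℝ) ^ (2 * k + 1) * ‖t‖ ^ (2 * (k + 1)) * ∑ i, ∫ ω, X ω i ^ (2 * (k + 1)) ∂P := by
        rw [integral_const_mul, integral_finsetSum _ fun i _ => ?_]
        exact integrable_comp_of_coord_abs_le P hX hB (g := fun v => v i ^ (2 * (k + 1)))
          (by fun_prop)
    _ ≤ (j : ℝ) ^ (2 * k + 1) * ‖t‖ ^ (2 * (k + 1)) * ∑ _i : Fin j, (K * (k + 1 : ℕ)) ^ (k + 1) := by
        gcongr with i _
        exact hK i
    _ = ((j : ℝ) ^ 2 * ‖t‖ ^ 2 * K * (k + 1 : ℕ)) ^ (k + 1) := by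
        rw [Finset.sum_const, Finset.card_univ, Fintype.card_fin, nsmul_eq_mul]
        ring

/-- Asymptotically equal mixed moments give asymptotically equal moments of every linear form. -/
theorem tendsto_integral_linForm_pow_sub {Ω : Type*} [MeasurableSpace Ω] (P : Measure Ω)
    [IsProbabilityMeasure P] {j : ℕ} (X Y : ℕ → Ω → (Fin j → ℝ)) (hX : ∀ n, Measurable (X n))
    (hY : ∀ n, Measurable (Y n)) (hbdd : ∀ n, ∃ B : ℝ, ∀ ω i, |X n ω i| ≤ B ∧ |Y n ω i| ≤ B)
    (hmom : ∀ e : Fin j → ℕ, Tendsto (fun n => (∫ ω, ∏ i, (X n ω i) ^ (e i) ∂P)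
      - ∫ ω, ∏ i, (Y n ω i) ^ (e i) ∂P) atTop (𝓝 0)) (t : Fin j → ℝ) (m : ℕ) :
    Tendsto (fun n => (∫ ω, (∑ i, X n ω i * t i) ^ m ∂P) - ∫ ω, (∑ i, Y n ω i * t i) ^ m ∂P)
      atTop (𝓝 0) := by
  have hexp : ∀ V : Ω → (Fin j → ℝ), Measurable V → (∃ B : ℝ, ∀ ω i, |V ω i| ≤ B) →
      ∫ ω, (∑ i, V ω i * t i) ^ m ∂P = ∑ g : Fin m → Fin j,
        (∏ l, t (g l)) * ∫ ω, ∏ i, V ω i ^ (univ.filter (fun l => g l = i)).card ∂P := by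
    intro V hV hB
    obtain ⟨B, hB⟩ := hB
    simp_rw [linForm_pow_eq_sum]
    rw [integral_finsetSum _ fun g _ => ?_]
    · simp_rw [integral_const_mul]
    · exact integrable_comp_of_coord_abs_le P hV hB
        (g := fun v => (∏ l, t (g l)) * ∏ i, v i ^ (univ.filter (fun l => g l = i)).card)
        (by fun_prop)
  have key : ∀ n, (∫ ω, (∑ i, X n ω i * t i) ^ m ∂P) - ∫ ω, (∑ i, Y n ω i * t i) ^ m ∂P
      = ∑ g : Fin m → Fin j, (∏ l, t (g l)) *
          ((∫ ω, ∏ i, X n ω i ^ (univ.filter (fun l => g l = i)).card ∂P)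
            - ∫ ω, ∏ i, Y n ω i ^ (univ.filter (fun l => g l = i)).card ∂P) := by
    intro n
    obtain ⟨B, hB⟩ := hbdd n
    rw [hexp (X n) (hX n) ⟨B, fun ω i => (hB ω i).1⟩, hexp (Y n) (hY n) ⟨B, fun ω i => (hB ω i).2⟩,
      ← Finset.sum_sub_distrib]
    simp_rw [mul_sub]
  simp_rw [key]
  rw [show (0 : ℝ) = ∑ g : Fin m → Fin j, (∏ l, t (g l)) * 0 by simp]
  exact tendsto_finsetSum _ fun g _ => (hmom _).const_mul _

/-- **Registered tool sub-goal `stub_momentsToCharDiff`** (of `stub_momentsToTests`): under the hypotheses of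
`MomentsToTests`, the characteristic functions of the laws of `X n` and `Y n` are asymptotically equal at every
linear form `v ↦ Σᵢ vᵢ tᵢ` (one-dimensional method of moments `tendsto_integral_cexp_sub_of_moments` applied to
the linear forms, whose moments expand into mixed moments and are sub-Gaussian by Jensen). -/
theorem stub_momentsToCharDiff :
    ∀ (Ω : Type) [MeasurableSpace Ω] (P : Measure Ω) [IsProbabilityMeasure P] (j : ℕ)
      (X Y : ℕ → Ω → (Fin j → ℝ)),
      (∀ n, Measurable (X n)) → (∀ n, Measurable (Y n)) →
      (∀ n, ∃ B : ℝ, ∀ ω i, |X n ω i| ≤ B ∧ |Y n ω i| ≤ B) →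
      (∃ K : ℝ, ∀ (n : ℕ) (i : Fin j) (k : ℕ),
        ∫ ω, (X n ω i) ^ (2 * k) ∂P ≤ (K * k) ^ k ∧ ∫ ω, (Y n ω i) ^ (2 * k) ∂P ≤ (K * k) ^ k) →
      (∀ e : Fin j → ℕ,
        Tendsto (fun n => (∫ ω, ∏ i, (X n ω i) ^ (e i) ∂P) - ∫ ω, ∏ i, (Y n ω i) ^ (e i) ∂P)
          atTop (𝓝 0)) →
      ∀ t : Fin j → ℝ,
        Tendsto (fun n => (∫ ω, Complex.exp ((∑ i, X n ω i * t i : ℝ) * Complex.I) ∂P)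
          - ∫ ω, Complex.exp ((∑ i, Y n ω i * t i : ℝ) * Complex.I) ∂P) atTop (𝓝 0) := by
  intro Ω _ P _ j X Y hX hY hbdd hK hmom t
  obtain ⟨K, hK⟩ := hK
  refine tendsto_integral_cexp_sub_of_moments P (fun n ω => ∑ i, X n ω i * t i)
    (fun n ω => ∑ i, Y n ω i * t i) (fun n => by have := hX n; fun_prop)
    (fun n => by have := hY n; fun_prop) (fun n => ?_) (C := (j : ℝ) ^ 2 * ‖t‖ ^ 2 * K)
    (fun n k => ?_) (tendsto_integral_linForm_pow_sub P X Y hX hY hbdd hmom t)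
  · obtain ⟨B, hB⟩ := hbdd n
    have ht : ∀ i, |t i| ≤ ‖t‖ := fun i => by simpa using norm_le_pi_norm t i
    have hb : ∀ (V : Ω → Fin j → ℝ) (ω : Ω), (∀ i, |V ω i| ≤ B) →
        |∑ i, V ω i * t i| ≤ ∑ _i : Fin j, B * ‖t‖ :=
      fun V ω hV => (Finset.abs_sum_le_sum_abs _ _).trans (Finset.sum_le_sum fun i _ => by
        rw [abs_mul]
        exact mul_le_mul (hV i) (ht i) (abs_nonneg _) ((abs_nonneg _).trans (hV i)))
    exact ⟨_, fun ω => ⟨hb (X n) ω fun i => (hB ω i).1, hb (Y n) ω fun i => (hB ω i).2⟩⟩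
  · obtain ⟨B, hB⟩ := hbdd n
    exact ⟨integral_linForm_pow_le P (hX n) (fun ω i => (hB ω i).1) t k fun i => (hK n i k).1,
      integral_linForm_pow_le P (hY n) (fun ω i => (hB ω i).2) t k fun i => (hK n i k).2⟩


end Summit.CriticalPhenomena.Ising3DConformalLimit.Cruxes.RotationJoining.RateSplitting

end
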